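import Mathlib.InformationTheory.KullbackLeibler.Basic
import Literature.MathematicalPhysics.KineticTheory.HardSphereEulerProofs
import HarnessLib

/-!
# Vocabulary of the line `IdeatorTwoSketch` (in-band Yau ledger) for the crux `MacroClosure`
(stmt-AtomisticToContinuum-14670; rank 6 of route `CollisionIsometryCLT`)

Definitions-only support file (`--supports stmt-AtomisticToContinuum-14670`) of the lead prover of the
line (`Cruxes/MacroClosure/Lines/IdeatorTwoSketch.lean`; skeleton registered on the item with the seven
stubs `stub_chamber`, `stub_referenceStatics`, `stub_blockLD`, `stub_thermo`, `stub_ledger`,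
`stub_balance`, `stub_gronwall`). It makes the line's vocabulary IMPORTABLE so that each registered
stub can land in its own sorry-free Theorems file with the registered signature verbatim: the types
`State`, `Flow`; the thermodynamic objects (`stateTemp`, `hsEntropy` = the `ησ` of
stmt-9520/9521/9525/9526 verbatim, `eulerFlux` = the `Fl` of stmt-9520, `relEnt`, `fluxRem`, `stateOf`,
`physDom`, `chamber`, `steeringActivity`); the kernel/block objects (`AdmissibleKernel` = the six
admissibility clauses of FMR/CTL/AB verbatim, `bρ bm bE bu bθ bD bq bU` = the block fields of FMR
verbatim); the ledger objects (`logProfilePair`, `Zpart`); and the six statements the stubs prove or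
consume (`ReferenceStatics`, `BlockLD`, `ThermoChamber`, `LedgerIdentity`, `BalanceIdentity`,
`EngineLocal`). All bodies are copied byte-for-byte from the registered skeleton; nothing is asserted
here (every `def … : Prop` is a predicate the stubs prove or consume, never a hypothesis taken as a
fact).

The mathematics (idea cards `entropy-ledger-gronwall` ≈ `liouville-yau-transport`, triage r1 pass ×2,
merged): Yau's relative entropy of the law CONDITIONED on the good event of the three closure
hypotheses, against the local Gibbs law steered by the classical solution (activity
`steeringActivity σ ρ_t`, velocity `u_t`, temperature `θ_t`), is by Liouville invariance an exact
LINEAR statistic of the empirical fields plus a log-partition difference (`LedgerIdentity`); its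
increment unfolds pathwise into CTL's collisional residual + the free-transport flux
(`BalanceIdentity`), which FMR closes on the hs-Euler flux of the block fields; the entropy-variable
calculus (`ThermoChamber`) kills every term linear in `Ū − U`, the quadratic remainder is paid by the
entropy inequality against the static block large deviations of the reference (`BlockLD`), hot cells by
AB (i), and Gronwall closes from zero initial defect (`ReferenceStatics` identifies the initial law with
the time-`0` reference); the readout is the tree's `tendstoHydroFieldsAt_of_klDiv`. In-band docking:
`EngineLocal` + `DiluteSelfConsistency` (stmt-3091) → the crux (re-typed stmt-14870 on the pre-shock items `AprioriBoundsPreShock`, `FastMomentRelaxationPreShock`).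
-/

noncomputable section

open MeasureTheory Filter Set Topology InformationTheory
open scoped ENNReal ContDiff

namespace Summit.AtomisticToContinuum.HydrodynamicLimit.Theorems.MacroClosureLine

open Literature.MathematicalPhysics.KineticTheory Literature.Analysis.FluidPDE
open Literature.Analysis.FunctionSpaces

/-! ## Vocabulary (abbreviations over tree declarations; all `Prop`s below are stated in it) -/

/-- Conserved state `U = (ρ, m, E)`. -/
abbrev State : Type := ℝ × V3 × ℝ

/-- Hard-sphere flows of `N + 1` spheres at reduced diameter `σ`. -/
abbrev Flow (σ : ℝ) (N : ℕ) : Type :=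
  HardSphereFlow (Torus.geometry (Fin 3)) (hsDiameter σ N) (N + 1)

/-- Temperature of a state, `θ(U) = (2/3)(E/ρ − |m|²/(2ρ²))`. -/
def stateTemp (U : State) : ℝ := 2 / 3 * (U.2.2 / U.1 - ‖U.2.1‖ ^ 2 / (2 * U.1 ^ 2))

/-- The convex hard-sphere entropy `η_σ(U) = −ρ((3/2) log θ − log ρ − f_ex(ρσ³))` (verbatim the `ησ`
of stmt-9520/9521/9525/9526). -/
def hsEntropy (σ : ℝ) (U : State) : ℝ :=
  -(U.1 * (3 / 2 * Real.log (2 / 3 * (U.2.2 / U.1 - ‖U.2.1‖ ^ 2 / (2 * U.1 ^ 2))) - Real.log U.1 -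
    hsExcessFreeEnergy (U.1 * σ ^ 3)))

/-- The hs-Euler flux in direction `j` (verbatim the `Fl` of stmt-9520):
`F_j(U) = (m_j, (m_j/ρ) m + p e_j, (E + p) m_j/ρ)`, `p = hsPressure σ ρ θ(U)`. -/
def eulerFlux (σ : ℝ) (j : Fin 3) (U : State) : State :=
  (U.2.1 j, (U.2.1 j / U.1) • U.2.1 + hsPressure σ U.1 (stateTemp U) • EuclideanSpace.single j (1 : ℝ),
    (U.2.2 + hsPressure σ U.1 (stateTemp U)) * U.2.1 j / U.1)

/-- Relative entropy density `h_σ(V | U) = η_σ(V) − η_σ(U) − Dη_σ(U)(V − U)`. -/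
def relEnt (σ : ℝ) (V U : State) : ℝ :=
  hsEntropy σ V - hsEntropy σ U - fderiv ℝ (hsEntropy σ) U (V - U)

/-- Flux Taylor remainder `R_j(V | U) = F_j(V) − F_j(U) − DF_j(U)(V − U)`. -/
def fluxRem (σ : ℝ) (j : Fin 3) (V U : State) : State :=
  eulerFlux σ j V - eulerFlux σ j U - fderiv ℝ (eulerFlux σ j) U (V - U)

/-- Conserved state of the primitive variables `(ρ, u, θ)`. -/
def stateOf (ρ : ℝ) (u : V3) (θ : ℝ) : State := (ρ, ρ • u, totalEnergyDensity ρ u θ)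

/-- The physical (open) state domain `{ρ > 0, θ(U) > 0}` = `{0 < ρ, |m|² < 2ρE}`. -/
def physDom : Set State := {U | 0 < U.1 ∧ ‖U.2.1‖ ^ 2 < 2 * U.1 * U.2.2}

/-- The dilute chamber at level `η`: physical states with packing `ρσ³ < η`. -/
def chamber (σ η : ℝ) : Set State := {U | 0 < U.1 ∧ U.1 * σ ^ 3 < η ∧ ‖U.2.1‖ ^ 2 < 2 * U.1 * U.2.2}

/-- The STEERING ACTIVITY of a density profile: `A_σ(ρ)(x) = ρ(x) · exp(f_ex(η) + η f_ex'(η))`,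
`η = ρ(x)σ³` (activity–density relation of the hard-sphere gas: `log a = log ρ + βμ_ex`). -/
def steeringActivity (σ : ℝ) (ρ : T3 → ℝ) (x : T3) : ℝ :=
  ρ x * Real.exp (hsExcessFreeEnergy (ρ x * σ ^ 3) +
    ρ x * σ ^ 3 * deriv hsExcessFreeEnergy (ρ x * σ ^ 3))

/-- Admissible kernel family (verbatim the six clauses of FMR / CTL / AB (ii)). -/
def AdmissibleKernel (γ C : ℝ) (φ : ℕ → T3 → ℝ) : Prop :=
  (∀ N, Torus.IsSmooth (φ N)) ∧ (∀ N y, 0 ≤ φ N y) ∧ (∀ N, ∫ y, φ N y = 1) ∧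
  (∀ (N : ℕ) y, ((N : ℝ) + 1) ^ (-γ) ≤ Torus.euclidDist y 0 → φ N y = 0) ∧
  (∀ (N : ℕ) y, φ N y ≤ C * ((N : ℝ) + 1) ^ (3 * γ)) ∧
  (∀ (N : ℕ) y, ‖Torus.gradient (φ N) y‖ ≤ C * ((N : ℝ) + 1) ^ (4 * γ))

section Blocks

variable {n : ℕ}

/-- Block density `ρ̄ = ⟨emp, φ(· − x)⟩`. -/
def bρ (φ : T3 → ℝ) (z : Config n (Fin 3) T3) (x : T3) : ℝ :=
  empiricalDensityField z (fun y => φ (y - x))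

/-- Block momentum `m̄`. -/
def bm (φ : T3 → ℝ) (z : Config n (Fin 3) T3) (x : T3) : V3 :=
  empiricalMomentumField z (fun y => φ (y - x))

/-- Block energy `Ē`. -/
def bE (φ : T3 → ℝ) (z : Config n (Fin 3) T3) (x : T3) : ℝ :=
  empiricalEnergyField z (fun y => φ (y - x))

/-- Block velocity `ū = ρ̄⁻¹ m̄` (junk `0` on empty blocks). -/
def bu (φ : T3 → ℝ) (z : Config n (Fin 3) T3) (x : T3) : V3 := (bρ φ z x)⁻¹ • bm φ z x

/-- Block temperature `θ̄ = (2/3)(Ē/ρ̄ − |m̄|²/(2ρ̄²))`. -/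
def bθ (φ : T3 → ℝ) (z : Config n (Fin 3) T3) (x : T3) : ℝ :=
  2 / 3 * (bE φ z x / bρ φ z x - ‖bm φ z x‖ ^ 2 / (2 * bρ φ z x ^ 2))

/-- Block traceless central kinetic stress `D_jk` (verbatim FMR's `D`). -/
def bD (φ : T3 → ℝ) (z : Config n (Fin 3) T3) (x : T3) (j k : Fin 3) : ℝ :=
  (∫ y, φ (y.1 - x) * ((y.2 j - bu φ z x j) * (y.2 k - bu φ z x k)) ∂(empiricalMeasure z)) -
    (if j = k then (∑ l : Fin 3, ∫ y, φ (y.1 - x) * (y.2 l - bu φ z x l) ^ 2 ∂(empiricalMeasure z)) / 3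
      else 0)

/-- Block kinetic heat flux `q` (verbatim FMR's `q`). -/
def bq (φ : T3 → ℝ) (z : Config n (Fin 3) T3) (x : T3) : V3 :=
  ∫ y, (φ (y.1 - x) * ‖y.2 - bu φ z x‖ ^ 2 / 2) • (y.2 - bu φ z x) ∂(empiricalMeasure z)

/-- Block conserved state `Ū = (ρ̄, m̄, Ē)`. -/
def bU (φ : T3 → ℝ) (z : Config n (Fin 3) T3) (x : T3) : State := (bρ φ z x, bm φ z x, bE φ z x)

end Blocks

/-- Empirical pairing with the log-profile of a local Gibbs parameter triple:
`⟨emp z, log (a(x) M_{1,u(x),θ(x)}(v))⟩`. -/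
def logProfilePair {n : ℕ} (a : T3 → ℝ) (u : T3 → V3) (θ : T3 → ℝ) (z : Config n (Fin 3) T3) : ℝ :=
  ∫ y, Real.log (localGibbsProfile a u θ y) ∂(empiricalMeasure z)

/-- The canonical partition function of the local Gibbs profile `(a, u, θ)` for `N + 1` spheres. -/
def Zpart (σ : ℝ) (N : ℕ) (a : T3 → ℝ) (u : T3 → V3) (θ : T3 → ℝ) : ℝ :=
  canonicalPartition (Torus.geometry (Fin 3)) (hsDiameter σ N) (N + 1) (localGibbsProfile a u θ)

/-! ## The stub statements -/

/-- STATICS 1 — the steering activity realises the prescribed smooth dilute state: for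
`0 < σ < 1/2`, smooth `(ρ, u, θ)` with `ρ, θ > 0`, `∫ρ = 1`, `ρσ³ < η₁`, the local Gibbs laws with
activity `A_σ(ρ)` are probability measures whose empirical density / momentum / energy fields
concentrate exponentially around `(ρ, ρu, E(ρ,u,θ))`, with a uniform second moment of the kinetic
energy, and `A_σ(ρ)` is (up to a constant factor) the ONLY dilute activity with this law of large
numbers. Cluster-expansion statics (ULGC, stmt-14445) + the activity–density identity. -/
def ReferenceStatics (η₁ : ℝ) : Prop :=
  ∀ σ : ℝ, 0 < σ → σ < 2⁻¹ → ∀ (ρ θ : T3 → ℝ) (u : T3 → V3),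
    Torus.IsSmooth ρ → Torus.IsSmooth θ → Torus.IsSmooth u → (∀ x, 0 < ρ x) → (∀ x, 0 < θ x) →
    (∀ x, ρ x * σ ^ 3 < η₁) → ∫ x, ρ x = 1 →
    Continuous (steeringActivity σ ρ) ∧ (∀ x, 0 < steeringActivity σ ρ x) ∧
    (∀ (N : ℕ) (Φ : Flow σ N), IsProbabilityMeasure (localGibbsLaw σ (steeringActivity σ ρ) u θ N Φ)) ∧
    (∀ χ : T3 → ℝ, Continuous χ → ∀ δ : ℝ, 0 < δ → ∃ C : ℝ, 0 < C ∧ ∀ (N : ℕ) (Φ : Flow σ N),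
      localGibbsLaw σ (steeringActivity σ ρ) u θ N Φ
          {z | δ < |empiricalDensityField z χ - ∫ x, χ x * ρ x|} ≤
        ENNReal.ofReal (C * Real.exp (-(C⁻¹ * (N + 1)))) ∧
      localGibbsLaw σ (steeringActivity σ ρ) u θ N Φ
          {z | δ < ‖empiricalMomentumField z χ - ∫ x, (χ x * ρ x) • u x‖} ≤
        ENNReal.ofReal (C * Real.exp (-(C⁻¹ * (N + 1)))) ∧
      localGibbsLaw σ (steeringActivity σ ρ) u θ N Φ
          {z | δ < |empiricalEnergyField z χ - ∫ x, χ x * totalEnergyDensity (ρ x) (u x) (θ x)|} ≤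
        ENNReal.ofReal (C * Real.exp (-(C⁻¹ * (N + 1))))) ∧
    (∃ C₂ : ℝ, ∀ (N : ℕ) (Φ : Flow σ N),
      ∫ z, (empiricalEnergyField z fun _ => (1 : ℝ)) ^ 2 ∂(localGibbsLaw σ (steeringActivity σ ρ) u θ N Φ)
        ≤ C₂) ∧
    (∀ a' : T3 → ℝ, Continuous a' → (∀ x, 0 < a' x) → σ ^ 3 * (⨆ x, a' x) ≤ η₁ * ∫ x, a' x →
      (∀ Φ : (N : ℕ) → Flow σ N,
        TendstoHydroFieldsAt (fun N => localGibbsLaw σ a' u θ N (Φ N)) Φ (fun _ => ρ) (fun _ => u)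
          (fun _ => θ) 0) →
      ∃ c : ℝ, 0 < c ∧ ∀ x, a' x = c * steeringActivity σ ρ x)

/-- STATICS 2 — block large deviations of dilute local Gibbs laws, in Varadhan's one-sided form
along a smooth space–time family: a bounded continuous block functional `∫ₓ G_s(x, Ū_N(z,x)) dx` that is
dominated pointwise by the relative entropy density `h_σ(· | U_s(x))` has non-positive specific
pressure under the steered local Gibbs law, uniformly in `s ∈ [0,t]` and in the flow:
`E_Ψ exp((N+1) ∫ₓ G_s(x, Ū)) ≤ e^{ε(N+1)}` eventually. -/
def BlockLD (η₂ : ℝ) : Prop :=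
  ∀ σ : ℝ, 0 < σ → σ < 2⁻¹ → ∀ (t : ℝ), 0 ≤ t → ∀ (ρ θ : ℝ → T3 → ℝ) (u : ℝ → T3 → V3),
    Torus.IsSmoothSpaceTimeOn (Icc 0 t) ρ → Torus.IsSmoothSpaceTimeOn (Icc 0 t) θ →
    Torus.IsSmoothSpaceTimeOn (Icc 0 t) u → (∀ s ∈ Icc 0 t, ∀ x, 0 < ρ s x) →
    (∀ s ∈ Icc 0 t, ∀ x, 0 < θ s x) → (∀ s ∈ Icc 0 t, ∀ x, ρ s x * σ ^ 3 < η₂) →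
    (∀ s ∈ Icc 0 t, ∫ x, ρ s x = 1) →
    ∀ (γ C : ℝ) (φ : ℕ → T3 → ℝ), 0 < γ → γ ≤ 1 / 15 → AdmissibleKernel γ C φ →
    ∀ (G : ℝ → T3 × State → ℝ) (B : ℝ), ContinuousOn (Function.uncurry G) (Icc 0 t ×ˢ univ) →
      (∀ s ∈ Icc 0 t, ∀ p, |G s p| ≤ B) →
      (∀ s ∈ Icc 0 t, ∀ x, ∀ V ∈ physDom, G s (x, V) ≤ relEnt σ V (stateOf (ρ s x) (u s x) (θ s x))) →
      ∀ ε : ℝ, 0 < ε → ∀ᶠ N : ℕ in atTop, ∀ s ∈ Icc 0 t, ∀ Φ : Flow σ N,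
        ∫ z, Real.exp (((N : ℝ) + 1) * ∫ x, G s (x, bU (φ N) z x))
            ∂(localGibbsLaw σ (steeringActivity σ (ρ s)) (u s) (θ s) N Φ) ≤
          Real.exp (ε * ((N : ℝ) + 1))

/-- THERMODYNAMICS in the chamber — for a classical hs-Euler solution with packing `< η₃`: the
entropy-variable field `Λ = Dη_σ(U_cl)` is smooth, has the explicit form
`Λ V = λ⁰ V.ρ + ⟪u/θ, V.m⟫ − V.E/θ` with `λ⁰ = log ρ + f_ex + ηf_ex' − (3/2)log θ − |u|²/(2θ) + 5/2`
(so the steered local Gibbs log-profile is `Λ·(1, v, |v|²/2) + const`), satisfies the entropy /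
entropy-flux compatibility `∂ₛΛ·V + Σⱼ ∂ⱼΛ·DFⱼ(U_cl)V = 0` and `∫ Σⱼ ∂ⱼΛ·Fⱼ(U_cl) = 0`; the
fluxes and the entropy are smooth on the chamber; and `h_σ(V|U)` is non-negative on the band and
bounded below by `m·min(|V−U|², |V−U|)` uniformly for `U` in compact parts of the chamber
(strict convexity at `U` from HsEosLowDensity, convexity on the band = HsFreeEnergyConvex 9526). -/
def ThermoChamber (η₃ : ℝ) : Prop :=
  ∀ σ : ℝ, 0 < σ →
    (ContDiffOn ℝ ∞ (hsEntropy σ) (chamber σ η₃) ∧ ∀ j, ContDiffOn ℝ ∞ (eulerFlux σ j) (chamber σ η₃)) ∧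
    (∀ K : Set State, IsCompact K → K ⊆ chamber σ η₃ → ∃ m : ℝ, 0 < m ∧ ∀ U ∈ K, ∀ V : State,
      0 < V.1 → V.1 * σ ^ 3 < 11 / 10 → ‖V.2.1‖ ^ 2 < 2 * V.1 * V.2.2 →
      m * min (‖V - U‖ ^ 2) ‖V - U‖ ≤ relEnt σ V U) ∧
    ∀ (T : ℝ) (ρ θ : ℝ → T3 → ℝ) (u : ℝ → T3 → V3), IsHardSphereEulerSolution σ T ρ u θ →
      (∀ s ∈ Ico 0 T, ∀ x, ρ s x * σ ^ 3 < η₃) →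
      let U : ℝ → T3 → State := fun s x => stateOf (ρ s x) (u s x) (θ s x)
      let Λ : ℝ → T3 → (State →L[ℝ] ℝ) := fun s x => fderiv ℝ (hsEntropy σ) (U s x)
      Torus.IsSmoothSpaceTimeOn (Ico 0 T) Λ ∧
      (∀ s ∈ Ico 0 T, ∀ x, ∀ V : State,
        Λ s x V = (Real.log (ρ s x) + hsExcessFreeEnergy (ρ s x * σ ^ 3) +
            ρ s x * σ ^ 3 * deriv hsExcessFreeEnergy (ρ s x * σ ^ 3) -
            3 / 2 * Real.log (θ s x) - ‖u s x‖ ^ 2 / (2 * θ s x) + 5 / 2) * V.1 +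
          inner ℝ ((θ s x)⁻¹ • u s x) V.2.1 - (θ s x)⁻¹ * V.2.2) ∧
      (∀ s ∈ Ico 0 T, ∀ x, ∀ V : State,
        Torus.timeDerivWithin (Ico 0 T) Λ s x V +
          ∑ j, Torus.partialDeriv j (Λ s) x (fderiv ℝ (eulerFlux σ j) (U s x) V) = 0) ∧
      (∀ s ∈ Ico 0 T, ∫ x, ∑ j, Torus.partialDeriv j (Λ s) x (eulerFlux σ j (U s x)) = 0)

/-- LEDGER — exact finite-`N` bookkeeping for local Gibbs references: (L0) the canonical local Gibbs
law is invariant under scaling of the activity; (L1) two-reference Liouville transport identity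
`H((Φ_t)_* P ‖ Ψ₂) = H(P ‖ Ψ₁) + (N+1) E_P[⟨emp, log prof₁⟩ − ⟨emp∘Φ_t, log prof₂⟩] + log Z₂ − log Z₁`
for any absolutely continuous initial law `P = W₀ · dZ`; (L2) the log-partition function of a smooth
one-parameter family of local Gibbs profiles is differentiable with derivative
`(N+1) E_{Ψ_s}⟨emp, ∂ₛ log prof_s⟩`, continuously in `s`. -/
def LedgerIdentity : Prop :=
  ∀ σ : ℝ, 0 < σ → σ < 2⁻¹ → ∀ (N : ℕ) (Φ : Flow σ N),
    (∀ (a θ : T3 → ℝ) (u : T3 → V3) (c : ℝ), 0 < c →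
      localGibbsLaw σ (fun x => c * a x) u θ N Φ = localGibbsLaw σ a u θ N Φ) ∧
    (∀ (a₁ θ₁ a₂ θ₂ : T3 → ℝ) (u₁ u₂ : T3 → V3), Continuous a₁ → Continuous θ₁ → Continuous u₁ →
      Continuous a₂ → Continuous θ₂ → Continuous u₂ → (∀ x, 0 < a₁ x) → (∀ x, 0 < θ₁ x) →
      (∀ x, 0 < a₂ x) → (∀ x, 0 < θ₂ x) →
      ∀ (W₀ : Config (N + 1) (Fin 3) T3 → ℝ), Measurable W₀ → (∀ z, 0 ≤ W₀ z) →
      IsProbabilityMeasure (particleLaw Φ W₀) →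
      klDiv (particleLaw Φ W₀) (localGibbsLaw σ a₁ u₁ θ₁ N Φ) ≠ ⊤ →
      ∀ t : ℝ,
      Integrable (fun z => ∫ y, ‖y.2‖ ^ 2 ∂(empiricalMeasure z)) (particleLaw Φ W₀) →
      Integrable (fun z => ∫ y, ‖y.2‖ ^ 2 ∂(empiricalMeasure (Φ.flow t z))) (particleLaw Φ W₀) →
      (klDiv (Φ.lawAt (particleLaw Φ W₀) t) (localGibbsLaw σ a₂ u₂ θ₂ N Φ)).toReal =
        (klDiv (particleLaw Φ W₀) (localGibbsLaw σ a₁ u₁ θ₁ N Φ)).toReal +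
          ((N : ℝ) + 1) * ((∫ z, logProfilePair a₁ u₁ θ₁ z ∂(particleLaw Φ W₀)) -
            ∫ z, logProfilePair a₂ u₂ θ₂ (Φ.flow t z) ∂(particleLaw Φ W₀)) +
          Real.log (Zpart σ N a₂ u₂ θ₂) - Real.log (Zpart σ N a₁ u₁ θ₁)) ∧
    (∀ (t : ℝ), 0 < t → ∀ (a θ : ℝ → T3 → ℝ) (u : ℝ → T3 → V3),
      Torus.IsSmoothSpaceTimeOn (Icc 0 t) a → Torus.IsSmoothSpaceTimeOn (Icc 0 t) θ →
      Torus.IsSmoothSpaceTimeOn (Icc 0 t) u → (∀ s ∈ Icc 0 t, ∀ x, 0 < a s x) →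
      (∀ s ∈ Icc 0 t, ∀ x, 0 < θ s x) →
      let dlog : ℝ → Config (N + 1) (Fin 3) T3 → ℝ := fun s z =>
        ∫ y, derivWithin (fun s' => Real.log (localGibbsProfile (a s') (u s') (θ s') y)) (Icc 0 t) s
          ∂(empiricalMeasure z)
      (∀ s ∈ Icc 0 t, HasDerivWithinAt (fun s' => Real.log (Zpart σ N (a s') (u s') (θ s')))
        (((N : ℝ) + 1) * ∫ z, dlog s z ∂(localGibbsLaw σ (a s) (u s) (θ s) N Φ)) (Icc 0 t) s) ∧
      ContinuousOn (fun s => ∫ z, dlog s z ∂(localGibbsLaw σ (a s) (u s) (θ s) N Φ)) (Icc 0 t))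

/-- BALANCE — pathwise and algebraic bookkeeping of the tested balance laws: (B1) on good
trajectories the position functional `⟨emp(Φ_s z), λ⁰_s⟩` is the time integral of
`⟨emp, ∂ₛλ⁰ + v·∇λ⁰⟩` (positions are continuous and piecewise free); (B2) the free-transport
derivative of CTL's observable `O` is the microscopic kinetic flux `⟨emp, Σⱼₖ ∂ⱼψₖ vⱼvₖ + Σⱼ ∂ⱼχ vⱼ|v|²/2⟩`;
(B3) the EXACT kinetic-flux algebra of non-negative kernels: block second moments
`= ρ̄ūⱼūₖ + ρ̄θ̄δⱼₖ + Dⱼₖ`, block energy current `= (Ē + ρ̄θ̄)ūⱼ + Σₖ Dⱼₖūₖ + qⱼ`; (B4) the mollifier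
commutator `|⟨emp, w g⟩ − ∫ₓ w(x)⟨emp, φ(·−x) g⟩| ≤ r‖∇w‖∞⟨emp, |g|⟩` for kernels supported in
`euclidDist(·,0) < r` with unit mass. -/
def BalanceIdentity : Prop :=
  (∀ σ : ℝ, 0 < σ → σ < 2⁻¹ → ∀ (N : ℕ) (Φ : Flow σ N) (t : ℝ), 0 < t →
    ∀ lam0 : ℝ → T3 → ℝ, Torus.IsSmoothSpaceTimeOn (Icc 0 t) lam0 →
    ∀ z ∈ Φ.good, ∀ τ ∈ Icc 0 t,
      (∫ y, lam0 τ y.1 ∂(empiricalMeasure (Φ.flow τ z))) - ∫ y, lam0 0 y.1 ∂(empiricalMeasure z) =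
        ∫ s in Icc 0 τ, ∫ y, (Torus.timeDerivWithin (Icc 0 t) lam0 s y.1 +
          ∑ j, y.2 j * Torus.partialDeriv j (lam0 s) y.1) ∂(empiricalMeasure (Φ.flow s z))) ∧
  (∀ (N : ℕ) (ψ : T3 → V3) (χ : T3 → ℝ), Torus.IsSmooth ψ → Torus.IsSmooth χ →
    ∀ z : Config (N + 1) (Fin 3) T3,
      HasDerivAt (fun r : ℝ => ∫ y, ((∑ j, ψ y.1 j * y.2 j) + χ y.1 * (‖y.2‖ ^ 2 / 2))
          ∂(empiricalMeasure (freeFlight (Torus.geometry (Fin 3)) r z)))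
        (∫ y, ((∑ j, ∑ k, Torus.partialDeriv j (fun x => ψ x k) y.1 * (y.2 j * y.2 k)) +
            ∑ j, Torus.partialDeriv j χ y.1 * (y.2 j * (‖y.2‖ ^ 2 / 2))) ∂(empiricalMeasure z)) 0) ∧
  (∀ (N : ℕ) (φ : T3 → ℝ), (∀ y, 0 ≤ φ y) → ∀ (z : Config (N + 1) (Fin 3) T3) (x : T3),
    (∀ j k : Fin 3, ∫ y, φ (y.1 - x) * (y.2 j * y.2 k) ∂(empiricalMeasure z) =
      bρ φ z x * (bu φ z x j * bu φ z x k) + (if j = k then bρ φ z x * bθ φ z x else 0) +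
        bD φ z x j k) ∧
    (∀ j : Fin 3, ∫ y, φ (y.1 - x) * (‖y.2‖ ^ 2 / 2 * y.2 j) ∂(empiricalMeasure z) =
      (bE φ z x + bρ φ z x * bθ φ z x) * bu φ z x j + (∑ k, bD φ z x j k * bu φ z x k) +
        bq φ z x j)) ∧
  (∀ (N : ℕ) (φ : T3 → ℝ) (r L : ℝ), (∀ y, 0 ≤ φ y) → Integrable φ → ∫ y, φ y = 1 →
    (∀ y, r ≤ Torus.euclidDist y 0 → φ y = 0) →
    ∀ w : T3 → ℝ, Torus.IsSmooth w → (∀ x, ‖Torus.gradient w x‖ ≤ L) →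
    ∀ (g : V3 → ℝ) (z : Config (N + 1) (Fin 3) T3),
      |(∫ y, w y.1 * g y.2 ∂(empiricalMeasure z)) -
          ∫ x, w x * ∫ y, φ (y.1 - x) * g y.2 ∂(empiricalMeasure z)| ≤
        r * L * ∫ y, |g y.2| ∂(empiricalMeasure z))

/-- The LOCAL IN-BAND ENGINE (profile-wise chamber level, matching the pre-shock hypotheses of the
re-typed crux stmt-14870): for all profiles there are `σ₀ > 0` and a dilute level `η > 0` such that for
`σ < σ₀` every classical solution with LLN-matching local Gibbs data that stays in the chamber
`ρσ³ < η` on `[0,T)` propagates the law of large numbers to every `t < T`. With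
`DiluteSelfConsistency` (stmt-3091, `∀ η > 0` outermost) this gives the conjunct. -/
def EngineLocal : Prop :=
  ∀ (a₀ θ₀ : T3 → ℝ) (u₀ : T3 → V3), Continuous a₀ → Continuous θ₀ → Continuous u₀ →
    (∀ x, 0 < a₀ x) → (∀ x, 0 < θ₀ x) →
    ∃ σ₀ : ℝ, 0 < σ₀ ∧ ∃ η : ℝ, 0 < η ∧ ∀ σ : ℝ, 0 < σ → σ < σ₀ →
      ∀ (T : ℝ) (ρ θ : ℝ → T3 → ℝ) (u : ℝ → T3 → V3), IsHardSphereEulerSolution σ T ρ u θ →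
        ∀ Φ : (N : ℕ) → Flow σ N,
          TendstoHydroFieldsAt (fun N => localGibbsLaw σ a₀ u₀ θ₀ N (Φ N)) Φ ρ u θ 0 →
            (∀ t ∈ Ico 0 T, ∀ x, ρ t x * σ ^ 3 < η) →
            ∀ t ∈ Ico 0 T, TendstoHydroFieldsAt (fun N => localGibbsLaw σ a₀ u₀ θ₀ N (Φ N)) Φ ρ u θ t

end Summit.AtomisticToContinuum.HydrodynamicLimit.Theorems.MacroClosureLine

end
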